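import Summits.Ventures.Crystal3D.Theorems.StickyWulffConstantNoReconstructionGainExactCriminalSmall
import Summits.Ventures.Crystal3D.Theorems.StickyWulffConstantNoReconstructionGainJointBoundLayeredRung
import HarnessLib

/-!
# EXACT₀ holds for (1/2, 1/20)-layered films: no layered criminal (the two crux lines meet)

HONEST FRAMING. Part of the venture `Summits/Ventures/Crystal3D` (cell `crystal3d-full`), supports the
crux `NoReconstructionGain` (stmt-Ventures-19144, route `route-Ventures-StickyWulffConstant`).  The
output of the line `joint-level-support-bound` (JB(1/2, 1/20), `layeredFilm20_adhesion`, wulff-p1 g16),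
re-expressed in the exact currency of the line `replication-exactness` (lead wulff-p1 g17):

* `exactZeroGain_of_layered20` — a film `Q` on a rigid half-crystal face `H(ν,s)` that carries an integer
  LAYER INDEX `L` such that, from every film ball `q`, each substrate plug is `1/2`-deep
  (`⟪z − q, ν⟫ ≤ −1/2`), each lower-layer partner is `1/2`-deep and each same-layer partner is
  `1/20`-level, has exact zero gain `X(H,Q) ≤ D(Q)` — for EVERY `ν`, every cut, no radius, no constant.
  Proof: `X := (all plug sites of Q) ∪ Q`, `P :=` the plug sites, `E := ∅` in `layeredFilm20_adhesion`;
  the cross count dominates the plug count;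
* `not_isCriminal_of_layered20` — hence **no criminal is (1/2, 1/20)-layered**: all fcc / hcp / Barlow /
  (100)- or (110)-stacked, ordered or disordered, `≤ 1/20`-rumpled films aligned with the face are excluded
  from the crux's minimal-counterexample class, in the exact form.

WHAT THIS IS NOT: non-layered films (misoriented grains, amorphous films) are the crux proper; rung F-C1
not moved.
-/

noncomputable section

namespace Summit.Ventures.Crystal3D.Theorems

open Summit.Ventures.Crystal3D
open Literature.MathematicalPhysics.StatisticalMechanics (fccStacking isHaggSeq_const
  le_dist_of_mem_barlowStacking_ideal contactDeficiency orderedContacts)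
open scoped InnerProductSpace
open Finset

/-- **EXACT₀ for (1/2, 1/20)-layered films** on every rigid half-crystal face. -/
theorem exactZeroGain_of_layered20 {ν : EuclideanSpace ℝ (Fin 3)} (hν : ‖ν‖ = 1) {s : ℝ}
    {Q : Finset (EuclideanSpace ℝ (Fin 3))} (hQ : IsFilmOn ν s Q) (L : EuclideanSpace ℝ (Fin 3) → ℤ)
    (hplug : ∀ q ∈ Q, ∀ z ∈ plugSet ν s q, ⟪z - q, ν⟫_ℝ ≤ -(1 / 2))
    (hfilm : ∀ q ∈ Q, ∀ y ∈ Q, dist q y = 1 →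
      (L y = L q → |⟪y - q, ν⟫_ℝ| ≤ 1 / 20) ∧ (L y < L q → ⟪y - q, ν⟫_ℝ ≤ -(1 / 2))) :
    (plugCount ν s Q : ℝ) ≤ contactDeficiency Q := by
  classical
  -- the finite set of all plug sites
  set Pl : Finset (EuclideanSpace ℝ (Fin 3)) :=
    Q.biUnion fun q => (plugSet_finite ν s q).toFinset with hPl
  have hmemPl : ∀ z, z ∈ Pl ↔ ∃ q ∈ Q, z ∈ plugSet ν s q := by
    intro z
    rw [hPl, Finset.mem_biUnion]
    constructor
    · rintro ⟨q, hq, hz⟩; exact ⟨q, hq, (Set.Finite.mem_toFinset _).1 hz⟩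
    · rintro ⟨q, hq, hz⟩; exact ⟨q, hq, (Set.Finite.mem_toFinset _).2 hz⟩
  have hPlH : ∀ z ∈ Pl, z ∈ halfCrystal ν s := by
    intro z hz
    obtain ⟨q, -, hzq⟩ := (hmemPl z).1 hz
    exact hzq.1
  have hdisj : Disjoint Pl Q := by
    rw [Finset.disjoint_left]
    intro z hz hzQ
    have := hQ.2 z hzQ z (hPlH z hz)
    rw [dist_self] at this; linarith
  set X := Pl ∪ Q with hX
  have hXQ : X \ Pl = Q := by rw [hX, Finset.union_sdiff_cancel_left hdisj]
  -- `X` is a packing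
  have hXpack : ∀ p ∈ X, ∀ q ∈ X, p ≠ q → 1 ≤ dist p q := by
    intro p hp q hq hne
    rw [hX, Finset.mem_union] at hp hq
    rcases hp with hp | hp <;> rcases hq with hq | hq
    · exact le_dist_of_mem_barlowStacking_ideal isHaggSeq_const one_pos fcc_height_sq (hPlH p hp).1
        (hPlH q hq).1 hne
    · rw [dist_comm]; exact hQ.2 q hq p (hPlH p hp)
    · exact hQ.2 p hp q (hPlH q hq)
    · exact hQ.1 p hp q hq hne
  -- the layered certificate
  have h := layeredFilm20_adhesion ν hν X Pl ∅ hXpack Finset.subset_union_left (Finset.empty_subset _) L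
    (by
      intro q hq y hy hd
      rw [Finset.sdiff_empty, hXQ] at hq
      constructor
      · intro hyP
        exact hplug q hq y ⟨hPlH y hyP, hd⟩
      · intro hyP
        have hyQ : y ∈ Q := by
          rw [hX, Finset.mem_union] at hy
          exact hy.resolve_left hyP
        exact hfilm q hq y hyQ hd)
  rw [hXQ, Finset.card_empty, Nat.cast_zero, mul_zero, add_zero] at h
  -- the plug count is the cross count from the plug sites
  refine le_trans ?_ h
  rw [card_cross_eq_sum, plugCount]; push_cast
  refine Finset.sum_le_sum fun q hq => ?_
  exact_mod_cast plugSet_ncard_le_card_filter ν s Pl q fun z hz => (hmemPl z).2 ⟨q, hq, hz⟩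

/-- **No criminal is (1/2, 1/20)-layered.** -/
theorem not_isCriminal_of_layered20 {ν : EuclideanSpace ℝ (Fin 3)} (hν : ‖ν‖ = 1) {s : ℝ}
    {Q : Finset (EuclideanSpace ℝ (Fin 3))} (L : EuclideanSpace ℝ (Fin 3) → ℤ)
    (hplug : ∀ q ∈ Q, ∀ z ∈ plugSet ν s q, ⟪z - q, ν⟫_ℝ ≤ -(1 / 2))
    (hfilm : ∀ q ∈ Q, ∀ y ∈ Q, dist q y = 1 →
      (L y = L q → |⟪y - q, ν⟫_ℝ| ≤ 1 / 20) ∧ (L y < L q → ⟪y - q, ν⟫_ℝ ≤ -(1 / 2))) :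
    ¬ IsCriminal ν s Q := by
  classical
  rintro ⟨hQ, hne, hcore⟩
  have h1 := hcore Q (Finset.Subset.refl Q) hne
  have h2 := exactZeroGain_of_layered20 hν hQ L hplug hfilm
  simp only [Finset.sdiff_self, Finset.empty_product, Finset.filter_empty, Finset.card_empty,
    Nat.cast_zero, add_zero] at h1
  linarith

end Summit.Ventures.Crystal3D.Theorems

end
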